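import Summits.CriticalPhenomena.PercolationContinuityZ3.Theorems.PercAnnulusCrossingIICManyPointsOneScaleCritical
import Summits.CriticalPhenomena.PercolationContinuityZ3.Theorems.PercAnnulusCrossingIICQuenchedManyPointsUpper
import HarnessLib

/-!
# The k-point function of Kesten's IIC at one scale: two-sided master statements (lane RSW3, p1 gen 20)

builds on p205010 (kernel theorem, internal audit signed; external expert review pending) — NOT used in this file
(only `p_c(ℤ^d) > 0`).

RSW3 lane (LANE 3 `prim-rsw3`), seat `prim-rsw3-p1` (gen 20).  Helper file (`--supports stmt-CriticalPhenomena-4575`);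
no definitions, no sorries.  Memo `run/shared/lean/prim/rsw3/P1-QM.md` §33.

The two halves of gen 20 in one statement each: the lower bounds of `…IICManyPointsOneScaleCritical` ((A2)□ + `CU⁺_l` + UAD; any finite
set of sites, one gluing factor `c_U`) and the upper bounds of `…IICManyPointsOneScaleUpper` / `…IICQuenchedManyPointsUpper` ((A2)□ alone;
separated sites):

* **`exists_iicMeasure_real_biInter_openConn_two_sided_oneScale_criticalProbI`** — at `p_c(ℤ^d)`, `d ≥ 2`, under (A2)□(s,L) + `CU⁺_l` + UAD:
  there are `n₀` and `0 < c, C, A` such that for every finite measure `ν` with Kesten's IIC limit property, every `n ≥ n₀` and every finite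
  `S` with `n ≤ ‖z‖_∞ ≤ 2n` on `S` and `z − z' ∉ Λ(2⌊n/4⌋)` for distinct `z, z' ∈ S`:
  **`c_U·(c·π_{p_c}(n))^{#S}·ν(univ) ≤ ν(S ⊆ C(0)) ≤ A·(C·π_{p_c}(n))^{#S}`** — THE k-POINT FUNCTION OF THE IIC AT ONE SCALE IS
  `≍ C^{±k}π(n)^k` ON SEPARATED SETS;
* **`exists_iicMeasure_real_inter_biInter_openConn_two_sided_oneScale_criticalProbI`** — the same GIVEN THE INSIDE: for every `b ≥ 1`, every
  local event `H` reading only the cluster of the origin inside `Λ(b)` and every `n ≥ n₀(b+1)`: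
  **`c_U·(c·π_{p_c}(n))^{#S}·ν(H) ≤ ν(H ∩ {S ⊆ C(0)}) ≤ A·(C·π_{p_c}(n))^{#S}·ν(H)`** — the k-point function at one scale FORGETS THE INSIDE.
References: H. Kesten, Probab. Theory Relat. Fields 73 (1986) Thm. (8); D. Basu, A. Sapozhnikov, ECP 22 (2017) Thm. 1.1.
-/

noncomputable section

namespace Summit.CriticalPhenomena.PercolationContinuityZ3.Theorems.Crossing

open MeasureTheory Filter Topology Literature.Probability.Percolation Literature.Probability.LatticeModels
open Literature.Probability.Percolation.DCT16
open Summit.CriticalPhenomena.PercolationContinuityZ3.Theorems.SurfaceTension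

variable {d : ℕ}

/-- **THE k-POINT FUNCTION OF KESTEN'S IIC AT ONE SCALE, TWO-SIDED** (`p_c(ℤ^d)`, `d ≥ 2`; (A2)□ at aspect `(s,L)`, `2 ≤ s ≤ L`, `ϰ > 0`;
`CU⁺_l(c_U)`, `l ≥ 2`, `c_U > 0`; UAD): there are `n₀ ≥ 1` and `0 < c, A, C` such that for every finite measure `ν` with Kesten's IIC limit
property, every `n ≥ n₀` and every finite set of sites `S` with `n ≤ ‖z‖_∞ ≤ 2n` on `S` and `z − z' ∉ Λ(2⌊n/4⌋)` for distinct `z, z' ∈ S`: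
**`c_U·(c·π_{p_c}(n))^{#S}·ν(univ) ≤ ν(⋂_{z∈S}{0 ↔ z}) ≤ A·(C·π_{p_c}(n))^{#S}`** (the lower half holds without the separation).
[cite: Kesten1986, Thm. (8)] [cite: BasuSapozhnikov2017ECP, Thm. 1.1] -/
theorem exists_iicMeasure_real_biInter_openConn_two_sided_oneScale_criticalProbI (hd : 2 ≤ d) {s L : ℕ} (hs : 2 ≤ s) (hsL : s ≤ L)
    {ϰ : ℝ} (hϰ : 0 < ϰ) (hA2 : SetToSetQuasiMultAspectAt d (criticalProbI d) s L ϰ) {l : ℕ} (hl : 2 ≤ l) {cU : ℝ} (hcU : 0 < cU)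
    (hCU : ∀ a : ℕ, 1 ≤ a → ∀ E : Set (BondConfig (Site d)), IsUpperSet E → MeasurableSet E →
      cU * (bondPercolation (zdGraph d) (criticalProbI d)).real E ≤ (bondPercolation (zdGraph d) (criticalProbI d)).real (E ∩
        {ω : BondConfig (Site d) | ∀ t ∈ innerBoundary (zdGraph d) (box d a), ∀ s ∈ innerBoundary (zdGraph d) (box d (l * a)),
          ∀ t' ∈ innerBoundary (zdGraph d) (box d a), ∀ s' ∈ innerBoundary (zdGraph d) (box d (l * a)),
          ω ∈ openConnIn (↑((box d (l * a) \ box d a) ∪ innerBoundary (zdGraph d) (box d a)) : Set (Site d)) t s →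
          ω ∈ openConnIn (↑((box d (l * a) \ box d a) ∪ innerBoundary (zdGraph d) (box d a)) : Set (Site d)) t' s' →
          ω ∈ openConnIn (↑((box d (l * a) \ box d a) ∪ innerBoundary (zdGraph d) (box d a)) : Set (Site d)) s s'}))
    (hUAD : ∀ ε : ℝ, 0 < ε → ∃ K₀ : ℕ, ∀ m : ℕ, 1 ≤ m → ∀ N : ℕ, K₀ * m ≤ N →
      (bondPercolation (zdGraph d) (criticalProbI d)).real (boxCrossing d m N) ≤ ε) :
    ∃ (n₀ : ℕ) (c A C : ℝ), 1 ≤ n₀ ∧ 0 < c ∧ 0 < A ∧ 0 < C ∧ ∀ (ν : Measure (BondConfig (Site d))) [IsFiniteMeasure ν],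
      (∀ (F : Finset (Sym2 (Site d))) (E : Set (BondConfig (Site d))), MeasurableSet E → DeterminedBy E ↑F →
        Tendsto (fun n : ℕ => (bondPercolation (zdGraph d) (criticalProbI d)).real (E ∩ siteToBoundary d n) /
          oneArmProb d (criticalProbI d) n) atTop (𝓝 (ν.real E))) →
      ∀ n : ℕ, n₀ ≤ n → ∀ S : Finset (Site d), (∀ z ∈ S, n ≤ Site.supNorm z ∧ Site.supNorm z ≤ 2 * n) →
        (∀ z ∈ S, ∀ z' ∈ S, z ≠ z' → z - z' ∉ box d (n / 4 + n / 4)) →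
          cU * (c * oneArmProb d (criticalProbI d) n) ^ S.card * ν.real Set.univ ≤
              ν.real (⋂ z ∈ S, (openConn (0 : Site d) z : Set (BondConfig (Site d)))) ∧
            ν.real (⋂ z ∈ S, (openConn (0 : Site d) z : Set (BondConfig (Site d)))) ≤
              A * (C * oneArmProb d (criticalProbI d) n) ^ S.card := by
  obtain ⟨n₁, c, hn₁, hc, hlow⟩ := exists_iicMeasure_real_biInter_openConn_ge_criticalProbI hd hs hsL hϰ hA2 hl hcU hCU hUAD
  obtain ⟨A, C, hA, hC, hup⟩ := exists_iicMeasure_real_biInter_openConn_le_oneScale_criticalProbI hd hs hsL hϰ hA2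
  refine ⟨max n₁ 8, c, A, C, le_trans hn₁ (le_max_left _ _), hc, hA, hC, fun ν _ hν n hn S hS hsep => ?_⟩
  exact ⟨hlow ν hν n ((le_max_left _ _).trans hn) S hS, hup ν hν n ((le_max_right _ _).trans hn) S hS hsep⟩

/-- **THE k-POINT FUNCTION OF KESTEN'S IIC AT ONE SCALE FORGETS THE INSIDE, TWO-SIDEDLY** (`p_c(ℤ^d)`, `d ≥ 2`; (A2)□ at aspect `(s,L)`,
`2 ≤ s ≤ L`, `ϰ > 0`; `CU⁺_l(c_U)`, `l ≥ 2`, `c_U > 0`; UAD): there are `n₀ ≥ 1` and `0 < c, A, C` such that for every finite measure `ν` with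
Kesten's IIC limit property, every inner scale `b ≥ 1`, every local event `H` reading only the cluster of the origin inside `Λ(b)` (with the
states of the pairs at it), every `n ≥ n₀(b+1)` and every finite `S` with `n ≤ ‖z‖_∞ ≤ 2n` on `S` and `z − z' ∉ Λ(2⌊n/4⌋)` for distinct
`z, z' ∈ S`: **`c_U·(c·π_{p_c}(n))^{#S}·ν(H) ≤ ν(H ∩ ⋂_{z∈S}{0 ↔ z}) ≤ A·(C·π_{p_c}(n))^{#S}·ν(H)`**.
[cite: Kesten1986, Thm. (8)] [cite: BasuSapozhnikov2017ECP, Thm. 1.1] -/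
theorem exists_iicMeasure_real_inter_biInter_openConn_two_sided_oneScale_criticalProbI (hd : 2 ≤ d) {s L : ℕ} (hs : 2 ≤ s)
    (hsL : s ≤ L) {ϰ : ℝ} (hϰ : 0 < ϰ) (hA2 : SetToSetQuasiMultAspectAt d (criticalProbI d) s L ϰ) {l : ℕ} (hl : 2 ≤ l)
    {cU : ℝ} (hcU : 0 < cU)
    (hCU : ∀ a : ℕ, 1 ≤ a → ∀ E : Set (BondConfig (Site d)), IsUpperSet E → MeasurableSet E →
      cU * (bondPercolation (zdGraph d) (criticalProbI d)).real E ≤ (bondPercolation (zdGraph d) (criticalProbI d)).real (E ∩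
        {ω : BondConfig (Site d) | ∀ t ∈ innerBoundary (zdGraph d) (box d a), ∀ s ∈ innerBoundary (zdGraph d) (box d (l * a)),
          ∀ t' ∈ innerBoundary (zdGraph d) (box d a), ∀ s' ∈ innerBoundary (zdGraph d) (box d (l * a)),
          ω ∈ openConnIn (↑((box d (l * a) \ box d a) ∪ innerBoundary (zdGraph d) (box d a)) : Set (Site d)) t s →
          ω ∈ openConnIn (↑((box d (l * a) \ box d a) ∪ innerBoundary (zdGraph d) (box d a)) : Set (Site d)) t' s' →
          ω ∈ openConnIn (↑((box d (l * a) \ box d a) ∪ innerBoundary (zdGraph d) (box d a)) : Set (Site d)) s s'}))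
    (hUAD : ∀ ε : ℝ, 0 < ε → ∃ K₀ : ℕ, ∀ m : ℕ, 1 ≤ m → ∀ N : ℕ, K₀ * m ≤ N →
      (bondPercolation (zdGraph d) (criticalProbI d)).real (boxCrossing d m N) ≤ ε) :
    ∃ (n₀ : ℕ) (c A C : ℝ), 1 ≤ n₀ ∧ 0 < c ∧ 0 < A ∧ 0 < C ∧ ∀ (ν : Measure (BondConfig (Site d))) [IsFiniteMeasure ν],
      (∀ (F : Finset (Sym2 (Site d))) (E : Set (BondConfig (Site d))), MeasurableSet E → DeterminedBy E ↑F →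
        Tendsto (fun n : ℕ => (bondPercolation (zdGraph d) (criticalProbI d)).real (E ∩ siteToBoundary d n) /
          oneArmProb d (criticalProbI d) n) atTop (𝓝 (ν.real E))) →
      ∀ (b : ℕ), 1 ≤ b → ∀ (H : Set (BondConfig (Site d))), IsLocalEvent H →
        (∀ ω ω' : BondConfig (Site d), ω ⊆ (zdGraph d).edgeSet → ω' ⊆ (zdGraph d).edgeSet →
          (∀ x, ω ∈ openConnIn (↑(box d b) : Set (Site d)) 0 x ↔ ω' ∈ openConnIn (↑(box d b) : Set (Site d)) 0 x) →
          (∀ x y, ω ∈ openConnIn (↑(box d b) : Set (Site d)) 0 x → y ∈ box d (b + 1) → (s(x, y) ∈ ω ↔ s(x, y) ∈ ω')) →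
          ω ∈ H → ω' ∈ H) →
        ∀ n : ℕ, n₀ * (b + 1) ≤ n → ∀ S : Finset (Site d), (∀ z ∈ S, n ≤ Site.supNorm z ∧ Site.supNorm z ≤ 2 * n) →
          (∀ z ∈ S, ∀ z' ∈ S, z ≠ z' → z - z' ∉ box d (n / 4 + n / 4)) →
            cU * (c * oneArmProb d (criticalProbI d) n) ^ S.card * ν.real H ≤
                ν.real (H ∩ ⋂ z ∈ S, (openConn (0 : Site d) z : Set (BondConfig (Site d)))) ∧
              ν.real (H ∩ ⋂ z ∈ S, (openConn (0 : Site d) z : Set (BondConfig (Site d)))) ≤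
                A * (C * oneArmProb d (criticalProbI d) n) ^ S.card * ν.real H := by
  obtain ⟨n₁, c, hn₁, hc, hlow⟩ := exists_iicMeasure_real_inter_biInter_openConnIn_ge_criticalProbI hd hs hsL hϰ hA2 hl hcU hCU hUAD
  obtain ⟨A, C, hA, hC, hup⟩ := exists_iicMeasure_real_inter_biInter_openConn_le_criticalProbI hd hs hsL hϰ hA2
  refine ⟨max n₁ (16 * s), c, A, C, le_trans hn₁ (le_max_left _ _), hc, hA, hC, fun ν _ hν b hb H hHl hH n hn S hS hsep => ?_⟩
  have hn1 : n₁ * b ≤ n := le_trans (Nat.mul_le_mul (le_max_left _ _) (Nat.le_succ b)) hn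
  have hn2 : 16 * s * (b + 1) ≤ n := le_trans (Nat.mul_le_mul_right _ (le_max_right _ _)) hn
  refine ⟨?_, hup ν hν b hb H hHl hH n hn2 S hS hsep⟩
  refine (hlow ν hν b n hb hn1 H hHl hH S hS).trans (measureReal_mono (Set.inter_subset_inter_right _ ?_) (measure_ne_top _ _))
  refine Set.iInter₂_mono fun z _ => ?_
  rw [Literature.Barriers.CriticalPhenomena.openConn_zero_eq_iUnion_openConnIn z]
  exact Set.subset_iUnion (fun m : ℕ => (openConnIn (↑(box d m) : Set (Site d)) (0 : Site d) z : Set (BondConfig (Site d)))) _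

end Summit.CriticalPhenomena.PercolationContinuityZ3.Theorems.Crossing

end
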